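import Summits.QuantumFields.YangMills.Theorems.UnitScaleTiltProp7GrowthAssembly
import Literature.MathematicalPhysics.QuantumFieldTheory.Balaban1983to89.BlockAveragingSU2Complex
import HarnessLib

/-!
# Route `UnitScaleTilt`, crux K1 child «MinimiserStabilityRegPr» (stmt-QuantumFields-19200), registered stub `stub_prop7From14` (leaf V3 «Prop 7 from a
# background (14)») — THE `ℓ²` GROWTH ASSEMBLY WITH CRITICALITY ON THE LIE ALGEBRA ONLY: **the Euler–Lagrange input is needed only for `𝔰𝔲(N)`-valued
# tangent fields; the Hermitian part of a secant is second order and is paid from the current bound** (`growth_of_growthModLin_proj`), and the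
# `𝔰𝔲(2)` projection lemmas the model instance consumes

Cell `ym3-torus` ∕ fleet seat `ym-ust-19200-p1` (gen 5).  CORRECTION OF SCOPE of this seat's `Prop7GrowthAssembly.wilsonAction4_sub_background_ge_of_modelCritical_T3`
(p528174): its criticality hypothesis `hEL : ∀ Z, T Z = 0 → Λ Z = 0` ranges over ALL `M₂(ℂ)`-valued bond fields `Z`, but the Euler–Lagrange equation of a critical
configuration on `SU(2)^{bonds}` (p2 lineage `Prop8Criticality.exists_tangent_lin_eq_zero_of_isCritR2_iter`: tangent fields `ξ(b) = D₀U₀(b)^*`, `D₀ ∈ T_{U₀(b)}SU(2)`)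
only gives `Λ = 0` on `𝔰𝔲(2)`-VALUED fields in `ker T`; on Hermitian-valued fields `Λ(Z) = −½ΣRe Tr(Z·J_h)` with `J_h` the Hermitian part of the current, which is
second order in the curvature but not zero — so p528174's `hEL` is stronger than what a critical point supplies.  THIS FILE states the assembly with the honest
hypothesis: `Λ` vanishes on `ker T ∩ {Z : proj∘Z = Z}` for a pointwise projection `proj` (here: onto the traceless anti-Hermitian part) that commutes with `T`, is
idempotent, respects differences and at most doubles norms; the secant `Y` is split as `proj∘Y + (Y − proj∘Y)` with `‖Y(b) − proj(Y(b))‖ ≤ ½‖Y(b)‖²` (for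
`Y = W − 1`, `W ∈ SU(2)`: `Y − proj Y = ½(W + W^* − 2) = −½(W−1)(W−1)^*`, using `Tr W ∈ ℝ`), and the Hermitian remainder is paid from the current bound `j₀` and the
`ℓ¹ → ℓ¹` bound `ν` of `T`.  Result: `(c − j₀(2B(κ + ν/2) + ½))·Σ‖Y‖² ≤ ΔA`.

WHAT IS PROVED (sorry-free, no definition; [folklore]).
* §1 **`growth_of_growthModLin_proj`** (abstract, finite index types, seminormed values).
* §2 the projection `X ↦ ½(X − X^*) − (Tr(½(X − X^*))/2)·1` on `M₂(ℂ)`, written out (no definition): `proj_sub`, `proj_sum`, `conjTranspose_proj`/`trace_proj`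
  (its values are traceless anti-Hermitian), `proj_of_skew_traceless` (identity on `𝔰𝔲(2)`), `proj_proj`, `norm_proj_le` (`≤ 2‖X‖`), `proj_conj_unitary` (commutes
  with unitary conjugation), `trace_coe_sub_conjTranspose_su2` (`Tr(W − W^*) = 0` on `SU(2)`), **`norm_sub_proj_le_of_su2`** (`‖(W−1) − proj(W−1)‖ ≤ ½‖W − 1‖²`).
* §3 **`annihilates_ker_of_tangent_span`**: the Euler–Lagrange equation in the tangent-span form of the p2 lineage (`ξ_{b,v}` with prescribed admissible value at
  a free bond, zero at the other free bonds, `Tξ = 0`, `Λξ = 0`) plus «a kernel field vanishing at the free bonds vanishes» gives the kernel form `hEL` used here.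
The model instance with these inputs is the sequel `UnitScaleTiltProp7ModelGrowth`.

References: T. Bałaban, CMP 102 (1985) 277–309 [Balaban1985Variational] ((22)–(28) pp.281–282, (127) p.297, (141)–(143) p.299).
-/

noncomputable section

open scoped BigOperators Matrix.Norms.L2Operator Matrix ComplexConjugate

namespace Summit.QuantumFields.YangMills.Theorems.Prop7GrowthAssembly

open Finset
open Literature.MathematicalPhysics.QuantumFieldTheory.Balaban1983to89 (SU2Mean.norm_trace_le)

/-! ## §1 The abstract spine with criticality on a projected subspace -/

section Abstract

variable {β γ : Type*} [Fintype β] [Fintype γ] {E E' : Type*} [SeminormedAddCommGroup E] [SeminormedAddCommGroup E']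

/-- **GROWTH FROM GROWTH MODULO THE LINEAR TERM, CRITICALITY ON THE PROJECTED SUBSPACE ONLY.**  Data: `Λ`, `T` respecting differences; a right inverse `H` of `T`
with `Σ‖HW‖ ≤ BΣ‖W‖`; pointwise projections `proj` (fine values) and `projW` (coarse values) with `T(proj∘Z) = projW∘(TZ)`, `projW` idempotent on the range,
`proj` respecting differences, idempotent, `‖proj x‖ ≤ 2‖x‖`; CRITICALITY: `Λ Z = 0` whenever `TZ = 0` AND `proj∘Z = Z`; the current bound `|Λ Z| ≤ j₀Σ‖Z‖`; the
`ℓ¹` bound `Σ_c‖TZ(c)‖ ≤ νΣ_b‖Z(b)‖`.  For a secant `Y` with `‖Y(b) − proj(Y(b))‖ ≤ ½‖Y(b)‖²`, fibre defect `Σ_c‖TY(c)‖ ≤ κΣ‖Y‖²` and growth modulo the linear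
term `cΣ‖Y‖² ≤ ΔA − Λ Y`: `(c − j₀(2B(κ + ν/2) + ½))·Σ‖Y‖² ≤ ΔA`. [folklore] -/
theorem growth_of_growthModLin_proj (Λ : (β → E) → ℝ) (T : (β → E) → (γ → E')) (H : (γ → E') → (β → E))
    (hΛsub : ∀ Z Z', Λ (Z - Z') = Λ Z - Λ Z') (hTsub : ∀ Z Z', T (Z - Z') = T Z - T Z') (hTH : ∀ W, T (H W) = W)
    {B : ℝ} (hB : 0 ≤ B) (hH : ∀ W, ∑ b, ‖H W b‖ ≤ B * ∑ c, ‖W c‖)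
    (proj : E → E) (projW : E' → E') (hTproj : ∀ Z, T (fun b => proj (Z b)) = fun c => projW (T Z c))
    (hprojW : ∀ Z c, projW (projW (T Z c)) = projW (T Z c))
    (hproj_sub : ∀ x y, proj (x - y) = proj x - proj y) (hproj_idem : ∀ x, proj (proj x) = proj x) (hproj_norm : ∀ x, ‖proj x‖ ≤ 2 * ‖x‖)
    (hEL : ∀ Z, (∀ b, proj (Z b) = Z b) → T Z = 0 → Λ Z = 0)
    {j₀ : ℝ} (hj₀ : 0 ≤ j₀) (hJ : ∀ Z, |Λ Z| ≤ j₀ * ∑ b, ‖Z b‖)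
    {ν : ℝ} (hν : 0 ≤ ν) (hTl1 : ∀ Z, ∑ c, ‖T Z c‖ ≤ ν * ∑ b, ‖Z b‖)
    (Y : β → E) (hYh : ∀ b, ‖Y b - proj (Y b)‖ ≤ (1 / 2) * ‖Y b‖ ^ 2)
    {κ : ℝ} (hF : ∑ c, ‖T Y c‖ ≤ κ * ∑ b, ‖Y b‖ ^ 2) {c ΔA : ℝ} (hG : c * ∑ b, ‖Y b‖ ^ 2 ≤ ΔA - Λ Y) :
    (c - j₀ * (2 * B * (κ + ν / 2) + 1 / 2)) * ∑ b, ‖Y b‖ ^ 2 ≤ ΔA := by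
  set S : ℝ := ∑ b, ‖Y b‖ ^ 2 with hS
  have hS0 : 0 ≤ S := Finset.sum_nonneg fun _ _ => sq_nonneg _
  -- the split `Y = Y_g + Y_h`
  set Yg : β → E := fun b => proj (Y b) with hYg
  have hYh1 : ∑ b, ‖(Y - Yg) b‖ ≤ (1 / 2) * S := by
    rw [hS, Finset.mul_sum]; exact Finset.sum_le_sum fun b _ => hYh b
  -- the defect of the good part
  set D : γ → E' := T Yg with hD
  have hD1 : ∑ c', ‖D c'‖ ≤ κ * S + ν * ((1 / 2) * S) := by
    have hsplit : D = T Y - T (Y - Yg) := by rw [hD, hTsub, sub_sub_cancel]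
    calc ∑ c', ‖D c'‖ = ∑ c', ‖T Y c' - T (Y - Yg) c'‖ := by rw [hsplit]; rfl
      _ ≤ ∑ c', (‖T Y c'‖ + ‖T (Y - Yg) c'‖) := Finset.sum_le_sum fun c' _ => norm_sub_le _ _
      _ = ∑ c', ‖T Y c'‖ + ∑ c', ‖T (Y - Yg) c'‖ := Finset.sum_add_distrib
      _ ≤ κ * S + ν * ((1 / 2) * S) := add_le_add hF ((hTl1 _).trans (mul_le_mul_of_nonneg_left hYh1 hν))
  -- the good correction `X_g = proj ∘ H D` is a preimage of `D` under `T`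
  set Xg : β → E := fun b => proj (H D b) with hXg
  have hTXg : T Xg = D := by
    rw [hXg, hTproj, hTH]
    funext c'
    rw [hD, hTproj, hprojW]
  -- criticality on `Y_g − X_g`
  have hgood : ∀ b, proj ((Yg - Xg) b) = (Yg - Xg) b := fun b => by
    simp only [Pi.sub_apply, hYg, hXg, hproj_sub, hproj_idem]
  have hker : T (Yg - Xg) = 0 := by rw [hTsub, hTXg, hD, sub_self]
  have hΛg : Λ Yg = Λ Xg := by have := hEL _ hgood hker; rw [hΛsub] at this; linarith
  -- bounds
  have hXg1 : ∑ b, ‖Xg b‖ ≤ 2 * (B * (κ * S + ν * ((1 / 2) * S))) := by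
    calc ∑ b, ‖Xg b‖ ≤ ∑ b, 2 * ‖H D b‖ := Finset.sum_le_sum fun b _ => hproj_norm _
      _ = 2 * ∑ b, ‖H D b‖ := by rw [Finset.mul_sum]
      _ ≤ 2 * (B * (κ * S + ν * ((1 / 2) * S))) := by
          refine mul_le_mul_of_nonneg_left ((hH D).trans (mul_le_mul_of_nonneg_left hD1 hB)) (by norm_num)
  have h1 : |Λ Xg| ≤ j₀ * (2 * (B * (κ * S + ν * ((1 / 2) * S)))) := (hJ Xg).trans (mul_le_mul_of_nonneg_left hXg1 hj₀)
  have h2 : |Λ (Y - Yg)| ≤ j₀ * ((1 / 2) * S) := (hJ _).trans (mul_le_mul_of_nonneg_left hYh1 hj₀)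
  have hΛY : Λ Y = Λ Xg + Λ (Y - Yg) := by rw [hΛsub, hΛg]; ring
  have h3 := neg_abs_le (Λ Xg)
  have h4 := neg_abs_le (Λ (Y - Yg))
  rw [hΛY] at hG
  nlinarith [h1, h2, h3, h4, hG, hS0]

end Abstract

/-! ## §2 The projection onto the traceless anti-Hermitian part of `M₂(ℂ)` -/

section Proj

/-- `proj(X − Y) = proj X − proj Y` for `proj X = ½(X − X^*) − (Tr(½(X − X^*))/2)·1`. [folklore] -/
theorem proj_sub (X Y : Matrix (Fin 2) (Fin 2) ℂ) :
    ((1 / 2 : ℂ) • ((X - Y) - (X - Y)ᴴ) - ((((1 / 2 : ℂ) • ((X - Y) - (X - Y)ᴴ)).trace / 2) • (1 : Matrix (Fin 2) (Fin 2) ℂ)))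
      = ((1 / 2 : ℂ) • (X - Xᴴ) - ((((1 / 2 : ℂ) • (X - Xᴴ)).trace / 2) • (1 : Matrix (Fin 2) (Fin 2) ℂ)))
        - ((1 / 2 : ℂ) • (Y - Yᴴ) - ((((1 / 2 : ℂ) • (Y - Yᴴ)).trace / 2) • (1 : Matrix (Fin 2) (Fin 2) ℂ))) := by
  rw [Matrix.conjTranspose_sub]
  simp only [smul_sub, Matrix.trace_sub, Matrix.trace_smul, sub_div, sub_smul, smul_eq_mul]
  abel

/-- `proj` of a finite sum is the sum of the `proj`'s. [folklore] -/
theorem proj_sum {ι : Type*} (s : Finset ι) (X : ι → Matrix (Fin 2) (Fin 2) ℂ) :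
    ((1 / 2 : ℂ) • ((∑ i ∈ s, X i) - (∑ i ∈ s, X i)ᴴ) - ((((1 / 2 : ℂ) • ((∑ i ∈ s, X i) - (∑ i ∈ s, X i)ᴴ)).trace / 2) • (1 : Matrix (Fin 2) (Fin 2) ℂ)))
      = ∑ i ∈ s, ((1 / 2 : ℂ) • (X i - (X i)ᴴ) - ((((1 / 2 : ℂ) • (X i - (X i)ᴴ)).trace / 2) • (1 : Matrix (Fin 2) (Fin 2) ℂ))) := by
  rw [Matrix.conjTranspose_sum]
  simp only [← Finset.sum_sub_distrib, Finset.smul_sum, Matrix.trace_sum, Finset.sum_div, Finset.sum_smul]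

/-- The values of `proj` are anti-Hermitian. [folklore] -/
theorem conjTranspose_proj (X : Matrix (Fin 2) (Fin 2) ℂ) :
    ((1 / 2 : ℂ) • (X - Xᴴ) - ((((1 / 2 : ℂ) • (X - Xᴴ)).trace / 2) • (1 : Matrix (Fin 2) (Fin 2) ℂ)))ᴴ
      = -((1 / 2 : ℂ) • (X - Xᴴ) - ((((1 / 2 : ℂ) • (X - Xᴴ)).trace / 2) • (1 : Matrix (Fin 2) (Fin 2) ℂ))) := by
  have htr : star (((1 / 2 : ℂ) • (X - Xᴴ)).trace / 2) = -(((1 / 2 : ℂ) • (X - Xᴴ)).trace / 2) := by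
    rw [Matrix.trace_smul, smul_eq_mul, Matrix.trace_sub, Matrix.trace_conjTranspose, star_div₀, star_mul', star_sub, star_star]
    have h2 : star (2 : ℂ) = 2 := by simp
    have h12 : star (1 / 2 : ℂ) = 1 / 2 := by simp
    rw [h2, h12]; ring
  rw [Matrix.conjTranspose_sub, Matrix.conjTranspose_smul, Matrix.conjTranspose_sub, Matrix.conjTranspose_conjTranspose, Matrix.conjTranspose_smul,
    Matrix.conjTranspose_one, htr]
  have : star (1 / 2 : ℂ) = 1 / 2 := by rw [Complex.star_def, map_div₀, map_one, Complex.conj_ofNat]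
  rw [this, neg_sub, smul_sub, smul_sub, neg_smul]
  abel

/-- The values of `proj` are traceless. [folklore] -/
theorem trace_proj (X : Matrix (Fin 2) (Fin 2) ℂ) :
    ((1 / 2 : ℂ) • (X - Xᴴ) - ((((1 / 2 : ℂ) • (X - Xᴴ)).trace / 2) • (1 : Matrix (Fin 2) (Fin 2) ℂ))).trace = 0 := by
  rw [Matrix.trace_sub, Matrix.trace_smul (((1 / 2 : ℂ) • (X - Xᴴ)).trace / 2), Matrix.trace_one, Fintype.card_fin]
  simp only [smul_eq_mul, Nat.cast_ofNat]
  ring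

/-- `proj` is the identity on traceless anti-Hermitian matrices. [folklore] -/
theorem proj_of_skew_traceless {X : Matrix (Fin 2) (Fin 2) ℂ} (hX : Xᴴ = -X) (htr : X.trace = 0) :
    ((1 / 2 : ℂ) • (X - Xᴴ) - ((((1 / 2 : ℂ) • (X - Xᴴ)).trace / 2) • (1 : Matrix (Fin 2) (Fin 2) ℂ))) = X := by
  have h2 : (1 / 2 : ℂ) • (X - Xᴴ) = X := by rw [hX, sub_neg_eq_add, ← two_smul ℂ X, smul_smul]; norm_num
  rw [h2, htr, zero_div, zero_smul, sub_zero]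

/-- `proj` is idempotent. [folklore] -/
theorem proj_proj (X : Matrix (Fin 2) (Fin 2) ℂ) :
    ((1 / 2 : ℂ) • (((1 / 2 : ℂ) • (X - Xᴴ) - ((((1 / 2 : ℂ) • (X - Xᴴ)).trace / 2) • (1 : Matrix (Fin 2) (Fin 2) ℂ)))
          - ((1 / 2 : ℂ) • (X - Xᴴ) - ((((1 / 2 : ℂ) • (X - Xᴴ)).trace / 2) • (1 : Matrix (Fin 2) (Fin 2) ℂ)))ᴴ)
        - ((((1 / 2 : ℂ) • (((1 / 2 : ℂ) • (X - Xᴴ) - ((((1 / 2 : ℂ) • (X - Xᴴ)).trace / 2) • (1 : Matrix (Fin 2) (Fin 2) ℂ)))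
          - ((1 / 2 : ℂ) • (X - Xᴴ) - ((((1 / 2 : ℂ) • (X - Xᴴ)).trace / 2) • (1 : Matrix (Fin 2) (Fin 2) ℂ)))ᴴ)).trace / 2) • (1 : Matrix (Fin 2) (Fin 2) ℂ)))
      = ((1 / 2 : ℂ) • (X - Xᴴ) - ((((1 / 2 : ℂ) • (X - Xᴴ)).trace / 2) • (1 : Matrix (Fin 2) (Fin 2) ℂ))) :=
  proj_of_skew_traceless (conjTranspose_proj X) (trace_proj X)

/-- `‖proj X‖ ≤ 2‖X‖`. [folklore] -/
theorem norm_proj_le (X : Matrix (Fin 2) (Fin 2) ℂ) :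
    ‖((1 / 2 : ℂ) • (X - Xᴴ) - ((((1 / 2 : ℂ) • (X - Xᴴ)).trace / 2) • (1 : Matrix (Fin 2) (Fin 2) ℂ)))‖ ≤ 2 * ‖X‖ := by
  set A : Matrix (Fin 2) (Fin 2) ℂ := (1 / 2 : ℂ) • (X - Xᴴ) with hA
  have hA1 : ‖A‖ ≤ ‖X‖ := by
    rw [hA, norm_smul]
    have : ‖X - Xᴴ‖ ≤ ‖X‖ + ‖X‖ := (norm_sub_le _ _).trans (by rw [Matrix.l2_opNorm_conjTranspose])
    have h12 : ‖(1 / 2 : ℂ)‖ = 1 / 2 := by simp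
    rw [h12]; linarith
  have hA2 : ‖(A.trace / 2) • (1 : Matrix (Fin 2) (Fin 2) ℂ)‖ ≤ ‖X‖ := by
    rw [norm_smul, norm_one, mul_one, norm_div, show ‖(2 : ℂ)‖ = (2 : ℝ) by simp, div_le_iff₀ (by norm_num : (0 : ℝ) < 2)]
    linarith [SU2Mean.norm_trace_le A]
  exact (norm_sub_le _ _).trans (by linarith)

/-- `proj` commutes with conjugation by a unitary: `proj(uXu^*) = u·proj(X)·u^*`. [folklore] -/
theorem proj_conj_unitary {u : Matrix (Fin 2) (Fin 2) ℂ} (hu : u ∈ Matrix.unitaryGroup (Fin 2) ℂ) (X : Matrix (Fin 2) (Fin 2) ℂ) :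
    ((1 / 2 : ℂ) • ((u * X * star u) - (u * X * star u)ᴴ) - ((((1 / 2 : ℂ) • ((u * X * star u) - (u * X * star u)ᴴ)).trace / 2) • (1 : Matrix (Fin 2) (Fin 2) ℂ)))
      = u * ((1 / 2 : ℂ) • (X - Xᴴ) - ((((1 / 2 : ℂ) • (X - Xᴴ)).trace / 2) • (1 : Matrix (Fin 2) (Fin 2) ℂ))) * star u := by
  have huu : u * star u = 1 := Matrix.mem_unitaryGroup_iff.mp hu
  have hc : (u * X * star u)ᴴ = u * Xᴴ * star u := by
    rw [Matrix.conjTranspose_mul, Matrix.conjTranspose_mul, ← Matrix.star_eq_conjTranspose u, ← Matrix.star_eq_conjTranspose (star u), star_star,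
      Matrix.mul_assoc]
  have hd : u * X * star u - u * Xᴴ * star u = u * (X - Xᴴ) * star u := by rw [Matrix.mul_sub, Matrix.sub_mul]
  have htr : ((1 / 2 : ℂ) • (u * (X - Xᴴ) * star u)).trace = ((1 / 2 : ℂ) • (X - Xᴴ)).trace := by
    rw [Matrix.trace_smul, Matrix.trace_smul, Matrix.mul_assoc, Matrix.trace_mul_comm, Matrix.mul_assoc, Matrix.mem_unitaryGroup_iff'.mp hu, Matrix.mul_one]
  rw [hc, hd, htr]
  conv_rhs => rw [Matrix.mul_sub, Matrix.sub_mul, Matrix.mul_smul, Matrix.smul_mul, Matrix.mul_smul, Matrix.smul_mul, Matrix.mul_one, huu]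

/-- **`Tr(W − W^*) = 0` on `SU(2)`** (`Tr W` is real: `W⁻¹ = W^* = adj W`, so `W₁₁ = conj W₀₀`). [folklore] -/
theorem trace_coe_sub_conjTranspose_su2 (W : Matrix.specialUnitaryGroup (Fin 2) ℂ) :
    ((W : Matrix (Fin 2) (Fin 2) ℂ) - (W : Matrix (Fin 2) (Fin 2) ℂ)ᴴ).trace = 0 := by
  obtain ⟨hU, hdet⟩ := Matrix.mem_specialUnitaryGroup_iff.1 W.2
  set V : Matrix (Fin 2) (Fin 2) ℂ := (W : Matrix (Fin 2) (Fin 2) ℂ) with hV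
  have h1 : star V * V = 1 := Matrix.mem_unitaryGroup_iff'.1 hU
  have hinv : V⁻¹ = star V := Matrix.inv_eq_left_inv h1
  have hadj : V⁻¹ = V.adjugate := by rw [Matrix.inv_def, hdet, Ring.inverse_one, one_smul]
  have h00 : star (V 0 0) = V 1 1 := by
    have h := congrFun (congrFun (hinv.symm.trans hadj) 0) 0
    rw [Matrix.star_apply, Matrix.adjugate_fin_two] at h
    simpa using h
  have h11 : star (V 1 1) = V 0 0 := by
    have h := congrFun (congrFun (hinv.symm.trans hadj) 1) 1
    rw [Matrix.star_apply, Matrix.adjugate_fin_two] at h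
    simpa using h
  rw [Matrix.trace_sub, Matrix.trace_fin_two, Matrix.trace_fin_two, Matrix.conjTranspose_apply, Matrix.conjTranspose_apply, h00, h11]
  ring

/-- **THE HERMITIAN PART OF A SECANT IS SECOND ORDER**: for `W ∈ SU(2)` and `Y = W − 1`, `‖Y − proj Y‖ ≤ ½‖Y‖²`
(`Y − proj Y = ½(W + W^* − 2) = −½(W − 1)(W − 1)^*`). [folklore] -/
theorem norm_sub_proj_le_of_su2 (W : Matrix.specialUnitaryGroup (Fin 2) ℂ) :
    ‖((W : Matrix (Fin 2) (Fin 2) ℂ) - 1)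
        - ((1 / 2 : ℂ) • (((W : Matrix (Fin 2) (Fin 2) ℂ) - 1) - ((W : Matrix (Fin 2) (Fin 2) ℂ) - 1)ᴴ)
          - ((((1 / 2 : ℂ) • (((W : Matrix (Fin 2) (Fin 2) ℂ) - 1) - ((W : Matrix (Fin 2) (Fin 2) ℂ) - 1)ᴴ)).trace / 2) • (1 : Matrix (Fin 2) (Fin 2) ℂ)))‖
      ≤ (1 / 2) * ‖(W : Matrix (Fin 2) (Fin 2) ℂ) - 1‖ ^ 2 := by
  set V : Matrix (Fin 2) (Fin 2) ℂ := (W : Matrix (Fin 2) (Fin 2) ℂ) with hV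
  have hU : V ∈ Matrix.unitaryGroup (Fin 2) ℂ := W.2.1
  have hVV : V * star V = 1 := Matrix.mem_unitaryGroup_iff.mp hU
  have hsub : (V - 1) - (V - 1)ᴴ = V - Vᴴ := by rw [Matrix.conjTranspose_sub, Matrix.conjTranspose_one]; abel
  have htr0 : ((1 / 2 : ℂ) • (V - Vᴴ)).trace = 0 := by rw [Matrix.trace_smul, trace_coe_sub_conjTranspose_su2 W, smul_zero]
  rw [hsub, htr0, zero_div, zero_smul, sub_zero]
  have hkey : V - 1 - (1 / 2 : ℂ) • (V - Vᴴ) = -((1 / 2 : ℂ) • ((V - 1) * (V - 1)ᴴ)) := by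
    rw [Matrix.conjTranspose_sub, Matrix.conjTranspose_one, ← Matrix.star_eq_conjTranspose, Matrix.sub_mul, Matrix.mul_sub, Matrix.mul_sub, hVV,
      Matrix.one_mul, Matrix.mul_one, Matrix.one_mul]
    ext i j
    simp only [Matrix.sub_apply, Matrix.smul_apply, Matrix.neg_apply, smul_eq_mul, Matrix.star_eq_conjTranspose]
    ring
  rw [hkey, norm_neg, norm_smul, show ‖(1 / 2 : ℂ)‖ = (1 / 2 : ℝ) by simp, sq]
  exact mul_le_mul_of_nonneg_left ((Matrix.l2_opNorm_mul _ _).trans (by rw [Matrix.l2_opNorm_conjTranspose])) (by norm_num)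

end Proj

/-! ## §3 From the Euler–Lagrange equation in tangent-span form to the kernel form -/

section KerForm

variable {β : Type*} {E F : Type*} [AddCommGroup E] [AddCommGroup F]

/-- **CRITICALITY IN TANGENT-SPAN FORM IMPLIES THE KERNEL FORM.**  Suppose that for every «free» bond `b` and every admissible value `v` (`good v`) there is a tangent
field `ξ_{b,v}` with `T ξ_{b,v} = 0`, `Λ ξ_{b,v} = 0`, `ξ_{b,v}(b) = v` and `ξ_{b,v} = 0` at the other free bonds (the shape of the p2 lineage's
`Prop8Criticality.exists_tangent_lin_eq_zero_of_isCritR2_iter`, multipliers on the complement `T₀` of the free bonds), and that a field in `ker T` vanishing at all free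
bonds vanishes (the corrector bonds are determined).  Then `Λ Z = 0` for every `Z ∈ ker T` with admissible values at the free bonds (`Z = Σ_b ξ_{b,Z(b)}`). [folklore] -/
theorem annihilates_ker_of_tangent_span (Λ : (β → E) →+ ℝ) (T : (β → E) →+ F) (free : Finset β) (good : E → Prop) (ξ : β → E → (β → E))
    (hξT : ∀ b ∈ free, ∀ v, good v → T (ξ b v) = 0) (hξΛ : ∀ b ∈ free, ∀ v, good v → Λ (ξ b v) = 0)
    (hξb : ∀ b ∈ free, ∀ v, good v → ξ b v b = v) (hξoff : ∀ b ∈ free, ∀ v, good v → ∀ b' ∈ free, b' ≠ b → ξ b v b' = 0)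
    (hinj : ∀ Z, T Z = 0 → (∀ b ∈ free, Z b = 0) → Z = 0)
    (Z : β → E) (hgood : ∀ b ∈ free, good (Z b)) (hTZ : T Z = 0) : Λ Z = 0 := by
  classical
  set Z' : β → E := Z - ∑ b ∈ free, ξ b (Z b) with hZ'
  have hT' : T Z' = 0 := by
    rw [hZ', map_sub, map_sum, hTZ, Finset.sum_eq_zero fun b hb => hξT b hb _ (hgood b hb), sub_zero]
  have hfree : ∀ b' ∈ free, Z' b' = 0 := by
    intro b' hb'
    rw [hZ', Pi.sub_apply, Finset.sum_apply, Finset.sum_eq_single b' (fun b hb hne => hξoff b hb _ (hgood b hb) b' hb' hne.symm)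
      (fun h => absurd hb' h), hξb b' hb' _ (hgood b' hb'), sub_self]
  have hZ : Z = ∑ b ∈ free, ξ b (Z b) := by
    have := hinj Z' hT' hfree
    rw [hZ', sub_eq_zero] at this
    exact this
  rw [hZ, map_sum]
  exact Finset.sum_eq_zero fun b hb => hξΛ b hb _ (hgood b hb)

end KerForm

end Summit.QuantumFields.YangMills.Theorems.Prop7GrowthAssembly

end
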